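import Summits.ValiantsHypothesis.ValiantsHypothesis.Theorems.LacunarySymmetroidMatrixDescartesWLawArrowLetters

/-!
# `MatrixDescartes` — line «finite» / «stamp»: the ARROW DESIGN on the support `(0,1,3)` — letters, Schur form of the
# determinant, the determinant polynomial and its degree (algebra behind the all-`m` theorem
# `FullyRealisable m ![0,1,3] (3m − 2)` of `…FiniteSectorLadderThree`)

HONEST FRAMING.  Object-search cell `pub-symmetroid`, seat val-sym-eng-3 g11 (census/instrument ENGINE #3 of D-0148 (b)).
HELPER of the crux item `stmt-ValiantsHypothesis-18050`
(`Summit.ValiantsHypothesis.ValiantsHypothesis.Theses.LacunarySymmetroid.MatrixDescartes`, asymptotic in `K`) with NO closure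
claim; no census constant is named here (pure matrix / polynomial bookkeeping); the realisability statement itself is assembled in
`…FiniteSectorLadderThree` from `fullyRealisable_of_certificate`, the scalar estimates live in `…FiniteSectorArrowEstimates`.
Nothing here bears on the crux or on `VP ≠ VNP`.

THE DESIGN (an arrowhead = star graph: `M` leaves and one hub placed LAST; index `Fin M ⊕ Fin 1` reindexed to `Fin (M+1)` by
`finSumFinEquiv`; base `B > 0`).  Letters `S₀, S₁, S₂` with top letter `S₂ = diag((-1)^{k+1}/B^{24(k+1)})_k ⊕ 0` DIAGONAL of rank
`M = m − 1`, `S₁` supported on the hub row/column only (ZERO leaf diagonal), so that (`arrowPencil_eval`)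
`S₀ + t S₁ + t³ S₂ = [[diag(a_k(t)), b(t)], [b(t)ᵀ, c(t)]]` with
* leaf diagonal `a_k(t) = (-1)^{k+1} (1 + t³/B^{24(k+1)})` — a BINOMIAL in `t³` with NO positive zero (constant sign `(-1)^{k+1}`),
* border `b_k(t) = 1/B^{k+1} − t/B^{9k+8} = B^{-(k+1)} (1 − t/B^{8k+7})` — affine, vanishing at `t = B^{8k+7}` (the «dip» of leaf `k`),
* corner `c(t) = ((-1)^M/B^{2M+2}) (1 − t/B^{8M+7})`.
By the Schur complement (`WLawArrow.det_arrow` / `WLawArrow.isSymm_arrow`, reused from the tree) `det = (∏_k a_k(t)) · h(t)` with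
`h(t) = c(t) − ∑_k b_k(t)²/a_k(t) = c(t) − ∑_k (-1)^{k+1} G_k(t)`, `G_k(t) = b_k(t)²/(1 + t³/B^{24(k+1)}) ≥ 0` (`det_arrowPencil`), and
`(∏ a_k)·h = c ∏ a_k − ∑_k b_k² ∏_{j≠k} a_j` (`arrowSchur_expand`) is the value of an explicit polynomial (`eval_arrowPoly`) of
`natDegree ≤ 3M + 1` (`natDegree_arrowPoly_le`).  Exact cross-check `m ≤ 8` (rational arithmetic, Sturm):
`HOME/val-sym-eng-3/g11/tools/arrow_check.py`.
[folklore] Schur complement of a block-diagonal arrowhead matrix; no citation is load-bearing.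
-/

-- `Summit.ValiantsHypothesis.ValiantsHypothesis.…` repeats a component by the D-0017 layout
-- (single-conjunct summit), which the `dupNamespace` linter flags; the name is mandated.
set_option linter.dupNamespace false

namespace Summit.ValiantsHypothesis.ValiantsHypothesis.Theorems.LacunarySymmetroidMatrixDescartes.FiniteSector

open scoped BigOperators Matrix
open Polynomial Finset Matrix
open Summit.ValiantsHypothesis.ValiantsHypothesis.Theorems.LacunarySymmetroidMatrixDescartes.WLawArrow
  (det_arrow isSymm_arrow)

/-! ## §1 The arrow pencil on `(0,1,3)`: letters, evaluation, symmetry, determinant, degree -/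

/-- **The pencil of the arrow letters, evaluated.**  With `M` leaves and the hub LAST (index `Fin M ⊕ Fin 1`
reindexed to `Fin (M+1)` by `finSumFinEquiv`): `S₀ + t S₁ + t³ S₂` is the arrowhead matrix with leaf diagonal
`a_k(t) = (-1)^{k+1} (1 + t³/B^{24(k+1)})`, border `b_k(t) = 1/B^{k+1} - t/B^{9k+8}` and corner
`c(t) = (-1)^M/B^{2M+2} - t (-1)^M/B^{10M+9}`. [bookkeeping] -/
theorem arrowPencil_eval (M : ℕ) (B t : ℝ) :
    (∑ l, t ^ (![0, 1, 3] : Fin 3 → ℕ) l •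
      (![Matrix.reindex finSumFinEquiv finSumFinEquiv
            (Matrix.fromBlocks (diagonal fun k : Fin M => (-1 : ℝ) ^ ((k : ℕ) + 1))
              (Matrix.of fun (k : Fin M) (_ : Fin 1) => 1 / B ^ ((k : ℕ) + 1))
              (Matrix.of fun (_ : Fin 1) (k : Fin M) => 1 / B ^ ((k : ℕ) + 1))
              (Matrix.of fun (_ _ : Fin 1) => (-1 : ℝ) ^ M / B ^ (2 * M + 2))),
          Matrix.reindex finSumFinEquiv finSumFinEquiv
            (Matrix.fromBlocks (diagonal fun _ : Fin M => (0 : ℝ))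
              (Matrix.of fun (k : Fin M) (_ : Fin 1) => -(1 / B ^ (9 * (k : ℕ) + 8)))
              (Matrix.of fun (_ : Fin 1) (k : Fin M) => -(1 / B ^ (9 * (k : ℕ) + 8)))
              (Matrix.of fun (_ _ : Fin 1) => -(-1 : ℝ) ^ M / B ^ (10 * M + 9))),
          Matrix.reindex finSumFinEquiv finSumFinEquiv
            (Matrix.fromBlocks (diagonal fun k : Fin M => (-1 : ℝ) ^ ((k : ℕ) + 1) / B ^ (24 * ((k : ℕ) + 1)))
              (Matrix.of fun (_ : Fin M) (_ : Fin 1) => (0 : ℝ))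
              (Matrix.of fun (_ : Fin 1) (_ : Fin M) => (0 : ℝ))
              (Matrix.of fun (_ _ : Fin 1) => (0 : ℝ)))] : Fin 3 → Matrix (Fin (M + 1)) (Fin (M + 1)) ℝ) l)
      = Matrix.reindex finSumFinEquiv finSumFinEquiv
          (Matrix.fromBlocks (diagonal fun k : Fin M => (-1 : ℝ) ^ ((k : ℕ) + 1) + (-1 : ℝ) ^ ((k : ℕ) + 1) / B ^ (24 * ((k : ℕ) + 1)) * t ^ 3)
            (Matrix.of fun (k : Fin M) (_ : Fin 1) => 1 / B ^ ((k : ℕ) + 1) + -(1 / B ^ (9 * (k : ℕ) + 8)) * t)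
            (Matrix.of fun (_ : Fin 1) (k : Fin M) => 1 / B ^ ((k : ℕ) + 1) + -(1 / B ^ (9 * (k : ℕ) + 8)) * t)
            (Matrix.of fun (_ _ : Fin 1) =>
              (-1 : ℝ) ^ M / B ^ (2 * M + 2) + -(-1 : ℝ) ^ M / B ^ (10 * M + 9) * t)) := by
  rw [Fin.sum_univ_three]
  simp only [Matrix.cons_val_zero, Matrix.cons_val_one, Matrix.cons_val_two, Matrix.head_cons,
    Matrix.tail_cons, pow_zero, one_smul, pow_one]
  ext i j
  simp only [Matrix.reindex_apply, Matrix.add_apply, Matrix.smul_apply, Matrix.submatrix_apply, smul_eq_mul]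
  rcases finSumFinEquiv.symm i with k | z <;> rcases finSumFinEquiv.symm j with k' | z'
  · simp only [Matrix.fromBlocks_apply₁₁, diagonal_apply]
    split_ifs <;> ring
  · simp only [Matrix.fromBlocks_apply₁₂, Matrix.of_apply]; ring
  · simp only [Matrix.fromBlocks_apply₂₁, Matrix.of_apply]; ring
  · simp only [Matrix.fromBlocks_apply₂₂, Matrix.of_apply]; ring

/-- The three arrow letters are symmetric. [bookkeeping] -/
theorem arrowPencil_isSymm (M : ℕ) (B : ℝ) (l : Fin 3) :
    ((![Matrix.reindex finSumFinEquiv finSumFinEquiv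
            (Matrix.fromBlocks (diagonal fun k : Fin M => (-1 : ℝ) ^ ((k : ℕ) + 1))
              (Matrix.of fun (k : Fin M) (_ : Fin 1) => 1 / B ^ ((k : ℕ) + 1))
              (Matrix.of fun (_ : Fin 1) (k : Fin M) => 1 / B ^ ((k : ℕ) + 1))
              (Matrix.of fun (_ _ : Fin 1) => (-1 : ℝ) ^ M / B ^ (2 * M + 2))),
          Matrix.reindex finSumFinEquiv finSumFinEquiv
            (Matrix.fromBlocks (diagonal fun _ : Fin M => (0 : ℝ))
              (Matrix.of fun (k : Fin M) (_ : Fin 1) => -(1 / B ^ (9 * (k : ℕ) + 8)))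
              (Matrix.of fun (_ : Fin 1) (k : Fin M) => -(1 / B ^ (9 * (k : ℕ) + 8)))
              (Matrix.of fun (_ _ : Fin 1) => -(-1 : ℝ) ^ M / B ^ (10 * M + 9))),
          Matrix.reindex finSumFinEquiv finSumFinEquiv
            (Matrix.fromBlocks (diagonal fun k : Fin M => (-1 : ℝ) ^ ((k : ℕ) + 1) / B ^ (24 * ((k : ℕ) + 1)))
              (Matrix.of fun (_ : Fin M) (_ : Fin 1) => (0 : ℝ))
              (Matrix.of fun (_ : Fin 1) (_ : Fin M) => (0 : ℝ))
              (Matrix.of fun (_ _ : Fin 1) => (0 : ℝ)))] : Fin 3 → Matrix (Fin (M + 1)) (Fin (M + 1)) ℝ) l).IsSymm := by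
  fin_cases l
  · exact (isSymm_arrow _ _ _).reindex _
  · exact (isSymm_arrow _ _ _).reindex _
  · exact (isSymm_arrow (fun k : Fin M => (-1 : ℝ) ^ ((k : ℕ) + 1) / B ^ (24 * ((k : ℕ) + 1))) (fun _ => 0) 0).reindex _

/-- **The determinant of the evaluated arrow pencil** (`t ≥ 0`, `B > 0`, so every leaf diagonal entry is non-zero):
`det = (∏_k a_k(t)) · (c(t) - ∑_k b_k(t)²/a_k(t))` (`WLawArrow.det_arrow`, Schur complement). [folklore] -/
theorem det_arrowPencil (M : ℕ) {B t : ℝ} (hB : 0 < B) (ht : 0 ≤ t) :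
    (Matrix.reindex finSumFinEquiv finSumFinEquiv
          (Matrix.fromBlocks (diagonal fun k : Fin M => (-1 : ℝ) ^ ((k : ℕ) + 1) + (-1 : ℝ) ^ ((k : ℕ) + 1) / B ^ (24 * ((k : ℕ) + 1)) * t ^ 3)
            (Matrix.of fun (k : Fin M) (_ : Fin 1) => 1 / B ^ ((k : ℕ) + 1) + -(1 / B ^ (9 * (k : ℕ) + 8)) * t)
            (Matrix.of fun (_ : Fin 1) (k : Fin M) => 1 / B ^ ((k : ℕ) + 1) + -(1 / B ^ (9 * (k : ℕ) + 8)) * t)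
            (Matrix.of fun (_ _ : Fin 1) =>
              (-1 : ℝ) ^ M / B ^ (2 * M + 2) + -(-1 : ℝ) ^ M / B ^ (10 * M + 9) * t))).det
      = (∏ k : Fin M, ((-1 : ℝ) ^ ((k : ℕ) + 1) + (-1 : ℝ) ^ ((k : ℕ) + 1) / B ^ (24 * ((k : ℕ) + 1)) * t ^ 3)) *
          (((-1 : ℝ) ^ M / B ^ (2 * M + 2) + -(-1 : ℝ) ^ M / B ^ (10 * M + 9) * t)
            - ∑ k : Fin M, (-1 : ℝ) ^ ((k : ℕ) + 1) *
                ((1 / B ^ ((k : ℕ) + 1) - t / B ^ (9 * (k : ℕ) + 8)) ^ 2 / (1 + t ^ 3 / B ^ (24 * ((k : ℕ) + 1))))) := by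
  have hfac : ∀ k : Fin M, (-1 : ℝ) ^ ((k : ℕ) + 1) + (-1 : ℝ) ^ ((k : ℕ) + 1) / B ^ (24 * ((k : ℕ) + 1)) * t ^ 3
      = (-1 : ℝ) ^ ((k : ℕ) + 1) * (1 + t ^ 3 / B ^ (24 * ((k : ℕ) + 1))) := fun k => by ring
  have ha : ∀ k : Fin M, (-1 : ℝ) ^ ((k : ℕ) + 1) + (-1 : ℝ) ^ ((k : ℕ) + 1) / B ^ (24 * ((k : ℕ) + 1)) * t ^ 3 ≠ 0 :=
    fun k => by rw [hfac]; exact mul_ne_zero (pow_ne_zero _ (by norm_num)) (by positivity)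
  rw [Matrix.det_reindex_self, det_arrow _ _ _ ha]
  congr 1
  congr 1
  refine Finset.sum_congr rfl fun k _ => ?_
  have hs : ((-1 : ℝ) ^ ((k : ℕ) + 1))⁻¹ = (-1) ^ ((k : ℕ) + 1) := by rw [← inv_pow, inv_neg, inv_one]
  rw [hfac, div_mul_eq_div_div, div_eq_mul_inv _ ((-1 : ℝ) ^ ((k : ℕ) + 1)), hs,
    show (1 / B ^ ((k : ℕ) + 1) + -(1 / B ^ (9 * (k : ℕ) + 8)) * t) = 1 / B ^ ((k : ℕ) + 1) - t / B ^ (9 * (k : ℕ) + 8) by ring]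
  ring

/-- **The Schur form written out as a polynomial expression**: for `t ≥ 0`,
`(∏ a_k)(c - ∑ b_k²/a_k) = c·∏ a_k - ∑_k b_k² ∏_{j ≠ k} a_j` (raw entries `a_k = a₀ + a₂ t³`, `b_k = b₀ + b₁ t`,
`c = c₀ + c₁ t` as they come out of the letters). [folklore] -/
theorem arrowSchur_expand (M : ℕ) {B t : ℝ} (hB : 0 < B) (ht : 0 ≤ t) :
    (∏ k : Fin M, ((-1 : ℝ) ^ ((k : ℕ) + 1) + (-1 : ℝ) ^ ((k : ℕ) + 1) / B ^ (24 * ((k : ℕ) + 1)) * t ^ 3)) *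
          (((-1 : ℝ) ^ M / B ^ (2 * M + 2) + -(-1 : ℝ) ^ M / B ^ (10 * M + 9) * t)
            - ∑ k : Fin M, (-1 : ℝ) ^ ((k : ℕ) + 1) *
                ((1 / B ^ ((k : ℕ) + 1) - t / B ^ (9 * (k : ℕ) + 8)) ^ 2 / (1 + t ^ 3 / B ^ (24 * ((k : ℕ) + 1)))))
      = ((-1 : ℝ) ^ M / B ^ (2 * M + 2) + -(-1 : ℝ) ^ M / B ^ (10 * M + 9) * t) *
            ∏ k : Fin M, ((-1 : ℝ) ^ ((k : ℕ) + 1) + (-1 : ℝ) ^ ((k : ℕ) + 1) / B ^ (24 * ((k : ℕ) + 1)) * t ^ 3)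
          - ∑ k : Fin M, (1 / B ^ ((k : ℕ) + 1) + -(1 / B ^ (9 * (k : ℕ) + 8)) * t) ^ 2 *
              ∏ j ∈ univ.erase k, ((-1 : ℝ) ^ ((j : ℕ) + 1) + (-1 : ℝ) ^ ((j : ℕ) + 1) / B ^ (24 * ((j : ℕ) + 1)) * t ^ 3) := by
  have hfac : ∀ k : Fin M, (-1 : ℝ) ^ ((k : ℕ) + 1) + (-1 : ℝ) ^ ((k : ℕ) + 1) / B ^ (24 * ((k : ℕ) + 1)) * t ^ 3
      = (-1 : ℝ) ^ ((k : ℕ) + 1) * (1 + t ^ 3 / B ^ (24 * ((k : ℕ) + 1))) := fun k => by ring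
  simp only [hfac]
  rw [mul_sub, mul_comm, Finset.mul_sum]
  congr 1
  refine Finset.sum_congr rfl fun k _ => ?_
  rw [← Finset.mul_prod_erase univ _ (mem_univ k)]
  have hpos : (0 : ℝ) < 1 + t ^ 3 / B ^ (24 * ((k : ℕ) + 1)) := by positivity
  have hs : ((-1 : ℝ) ^ ((k : ℕ) + 1)) * (-1) ^ ((k : ℕ) + 1) = 1 := by
    rw [← pow_add, ← two_mul, pow_mul]; norm_num
  have hs2 : ((-1 : ℝ) ^ ((k : ℕ) + 1)) ^ 2 = 1 := by rw [sq, hs]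
  field_simp
  rw [hs2]
  ring

/-- **The arrow polynomial evaluates to the expanded Schur form.** [bookkeeping] -/
theorem eval_arrowPoly (M : ℕ) (B t : ℝ) :
    ((C ((-1 : ℝ) ^ M / B ^ (2 * M + 2)) + C (-(-1 : ℝ) ^ M / B ^ (10 * M + 9)) * X) *
          ∏ k : Fin M, (C ((-1 : ℝ) ^ ((k : ℕ) + 1)) + C ((-1 : ℝ) ^ ((k : ℕ) + 1) / B ^ (24 * ((k : ℕ) + 1))) * X ^ 3)
        - ∑ k : Fin M, (C (1 / B ^ ((k : ℕ) + 1)) + C (-(1 / B ^ (9 * (k : ℕ) + 8))) * X) ^ 2 *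
            ∏ j ∈ univ.erase k, (C ((-1 : ℝ) ^ ((j : ℕ) + 1)) + C ((-1 : ℝ) ^ ((j : ℕ) + 1) / B ^ (24 * ((j : ℕ) + 1))) * X ^ 3)).eval t
      = ((-1 : ℝ) ^ M / B ^ (2 * M + 2) + -(-1 : ℝ) ^ M / B ^ (10 * M + 9) * t) *
            ∏ k : Fin M, ((-1 : ℝ) ^ ((k : ℕ) + 1) + (-1 : ℝ) ^ ((k : ℕ) + 1) / B ^ (24 * ((k : ℕ) + 1)) * t ^ 3)
          - ∑ k : Fin M, (1 / B ^ ((k : ℕ) + 1) + -(1 / B ^ (9 * (k : ℕ) + 8)) * t) ^ 2 *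
              ∏ j ∈ univ.erase k, ((-1 : ℝ) ^ ((j : ℕ) + 1) + (-1 : ℝ) ^ ((j : ℕ) + 1) / B ^ (24 * ((j : ℕ) + 1)) * t ^ 3) := by
  simp only [eval_sub, eval_mul, eval_add, eval_pow, eval_C, eval_X, eval_prod, eval_finsetSum]

/-- **Degree of the arrow polynomial**: `≤ 3M + 1` (the top product has degree `≤ 1 + 3M`, each border term
`≤ 2 + 3(M-1)`). [bookkeeping] -/
theorem natDegree_arrowPoly_le (M : ℕ) (B : ℝ) :
    ((C ((-1 : ℝ) ^ M / B ^ (2 * M + 2)) + C (-(-1 : ℝ) ^ M / B ^ (10 * M + 9)) * X) *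
          ∏ k : Fin M, (C ((-1 : ℝ) ^ ((k : ℕ) + 1)) + C ((-1 : ℝ) ^ ((k : ℕ) + 1) / B ^ (24 * ((k : ℕ) + 1))) * X ^ 3)
        - ∑ k : Fin M, (C (1 / B ^ ((k : ℕ) + 1)) + C (-(1 / B ^ (9 * (k : ℕ) + 8))) * X) ^ 2 *
            ∏ j ∈ univ.erase k, (C ((-1 : ℝ) ^ ((j : ℕ) + 1)) + C ((-1 : ℝ) ^ ((j : ℕ) + 1) / B ^ (24 * ((j : ℕ) + 1))) * X ^ 3)).natDegree
      ≤ 3 * M + 1 := by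
  have hcub : ∀ (a b : ℝ), (C a + C b * X ^ 3 : ℝ[X]).natDegree ≤ 3 := fun a b =>
    (natDegree_add_le _ _).trans (max_le (by simp) ((natDegree_C_mul_le _ _).trans (by simp)))
  have hlin : ∀ (a b : ℝ), (C a + C b * X : ℝ[X]).natDegree ≤ 1 := fun a b =>
    (natDegree_add_le _ _).trans (max_le (by simp) ((natDegree_C_mul_le _ _).trans natDegree_X_le))
  refine (natDegree_sub_le _ _).trans (max_le ?_ ?_)
  · refine natDegree_mul_le.trans ?_
    have h1 := hlin ((-1 : ℝ) ^ M / B ^ (2 * M + 2)) (-(-1 : ℝ) ^ M / B ^ (10 * M + 9))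
    have h2 : (∏ k : Fin M, (C ((-1 : ℝ) ^ ((k : ℕ) + 1)) + C ((-1 : ℝ) ^ ((k : ℕ) + 1) / B ^ (24 * ((k : ℕ) + 1))) * X ^ 3)).natDegree
        ≤ 3 * M := by
      refine (natDegree_prod_le _ _).trans ?_
      refine (Finset.sum_le_card_nsmul _ _ 3 fun k _ => hcub _ _).trans ?_
      rw [card_univ, Fintype.card_fin, smul_eq_mul]
      omega
    omega
  · refine (natDegree_sum_le_of_forall_le _ _ fun k _ => ?_)
    refine natDegree_mul_le.trans ?_
    have h1 : ((C (1 / B ^ ((k : ℕ) + 1)) + C (-(1 / B ^ (9 * (k : ℕ) + 8))) * X) ^ 2 : ℝ[X]).natDegree ≤ 2 :=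
      natDegree_pow_le.trans (by have := hlin (1 / B ^ ((k : ℕ) + 1)) (-(1 / B ^ (9 * (k : ℕ) + 8))); omega)
    have h2 : (∏ j ∈ univ.erase k, (C ((-1 : ℝ) ^ ((j : ℕ) + 1)) + C ((-1 : ℝ) ^ ((j : ℕ) + 1) / B ^ (24 * ((j : ℕ) + 1))) * X ^ 3)).natDegree
        ≤ 3 * (M - 1) := by
      refine (natDegree_prod_le _ _).trans ?_
      refine (Finset.sum_le_card_nsmul _ _ 3 fun j _ => hcub _ _).trans ?_
      rw [Finset.card_erase_of_mem (mem_univ k), card_univ, Fintype.card_fin, smul_eq_mul]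
      omega
    have hM : 1 ≤ M := Nat.succ_le_of_lt (Nat.lt_of_le_of_lt (Nat.zero_le _) k.isLt)
    omega

end Summit.ValiantsHypothesis.ValiantsHypothesis.Theorems.LacunarySymmetroidMatrixDescartes.FiniteSector
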